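import Summits.Ventures.CertifiedManyBodySolver.Downfold.EmeryShapeTrueCornerRule
import Summits.Ventures.CertifiedManyBodySolver.Downfold.EmeryFermiScalePointsNdNiO2YK26TrueCorners
import Summits.Ventures.CertifiedManyBodySolver.Downfold.EmeryFermiScalePointsNdNiO2YK26VirtualCorners
import HarnessLib

/-!
# THE ONE-BAND FERMI-SURFACE SHAPE `t′/t` OF THE WHOLE TYPED 3BE BOX `emeryBoxNdNiO2YK26Src (EmeryBoxesKSlicesD)` AT ITS TWO TRUE CORNERS (true-corner rule under certified margins, §B.87 (i);
# router/EMERY-SHAPE-CORNERS.tsv «true» rows)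

Venture CertifiedManyBodySolver, cell `pub/hubbard-downfold` (stage S1; INFLATION-RULES-3to1-B §B.87 (i)), seat hubbard-downfold-mod-4 (technique B, g35); namespace
`Summit.Ventures.CertifiedManyBodySolver.Downfold.Emery`. Everything PROVED (0 sorry). WHAT THIS IS NOT: a statement about NdNiO₂ ((K)+YNiO₂ proxy source box; n_H 1.09) — the typed box is SCREENING-GRADE; `U = 0`
one-body kinematics of the σ model; object E = the EXACT `t–t′` shape of the σ Fermi surface at the row's own Fermi energy.

For EVERY one-body row of `[3.97, 5] × [1.17, 1.37] × [0.56, 0.68] × [0.121, 0.123]` eV the one-band `t′/t` lies between its values at the TRUE corners `(Δ₁, a₁, b₂, c₂)` and `(Δ₂, a₂, b₁, c₁)`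
(`EmeryShapeTrueCornerRule`; the t_pp / t_pp′ directions by the MARGIN LEVERS of `EmeryMarginLevers`, margins certified by `norm_num` with the constants `M` printed below), read
over their K = 384 brackets (`EmeryFermiScalePointsNdNiO2YK26TrueCorners`).

| filling | **true-corner window (certified)** | margins (t_pp lower/upper; t_pp′ lower/upper) | two-ray (§B.86 (i)) | g19 sub-box device |
|---|---|---|---|---|
| n_H = 1.09 (ν = 91/200) | **[-0.231, -0.1759]** | M_b 0.0 / 0.2678; M_c 1.1377 / 0.519 | see EmeryBoxesNdNiO2YK26ShapeCorners | [-0.2344,-0.1532] (12 sub-boxes, Δ hull [3.97,6.24] × family filling band) |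

Sources: three-band model [HybertsenSchluterChristensen1989, Eq. (1)]; [AndersenEtAl1995, §6]; box rows as cited in the typed object's file.
-/

noncomputable section

namespace Summit.Ventures.CertifiedManyBodySolver.Downfold.Emery

open Real Set

/-- **n_H = 1.09 (ν = 91/200): for every row of the box the one-band Fermi-surface `t′/t` (object E) lies in `[-0.231, -0.1759]` — its values at the two TRUE corners** (margin levers; margins by `norm_num`). [folklore] -/
theorem ndNiO2YK26Box_fsRatio_true_nH109 {Δ a b c : ℝ} (hΔ : Δ ∈ Icc ((397 : ℝ) / 100) (5 : ℝ)) (ha : a ∈ Icc ((117 : ℝ) / 100) ((137 : ℝ) / 100)) (hb : b ∈ Icc ((14 : ℝ) / 25) ((17 : ℝ) / 25)) (hc : c ∈ Icc ((121 : ℝ) / 1000) ((123 : ℝ) / 1000)) :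
    fsRatio Δ a b c (fermiEnergyOf Δ a b c ((91 : ℝ) / 200)) ∈ Icc ((-231 : ℝ) / 1000) ((-1759 : ℝ) / 10000) := by
  have hSL := (fermiEnergyOf_of_pointBracketCheck truePt_NdNiO2YK26SL_nH109_br (by norm_num) (by norm_num) (by norm_num) (ν := (91/200 : ℝ)) (by push_cast; exact ⟨le_rfl, le_rfl⟩)).2
  have hTL := (fermiEnergyOf_of_pointBracketCheck truePt_NdNiO2YK26TL_nH109_br (by norm_num) (by norm_num) (by norm_num) (ν := (91/200 : ℝ)) (by push_cast; exact ⟨le_rfl, le_rfl⟩)).2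
  have hSU := (fermiEnergyOf_of_pointBracketCheck truePt_NdNiO2YK26SU_nH109_br (by norm_num) (by norm_num) (by norm_num) (ν := (91/200 : ℝ)) (by push_cast; exact ⟨le_rfl, le_rfl⟩)).2
  have hQU := (fermiEnergyOf_of_pointBracketCheck truePt_NdNiO2YK26QU_nH109_br (by norm_num) (by norm_num) (by norm_num) (ν := (91/200 : ℝ)) (by push_cast; exact ⟨le_rfl, le_rfl⟩)).2
  have hTH := (fermiEnergyOf_of_pointBracketCheck truePt_NdNiO2YK26TH_nH109_br (by norm_num) (by norm_num) (by norm_num) (ν := (91/200 : ℝ)) (by push_cast; exact ⟨le_rfl, le_rfl⟩)).2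
  have hAlo := (fermiEnergyOf_of_pointBracketCheck virtPt_NdNiO2YK26Alo_nH109_br (by norm_num) (by norm_num) (by norm_num) (ν := (91/200 : ℝ)) (by push_cast; exact ⟨le_rfl, le_rfl⟩)).2
  have hTop := (fermiEnergyOf_of_pointBracketCheck virtPt_NdNiO2YK26H_nH109_br (by norm_num) (by norm_num) (by norm_num) (ν := (91/200 : ℝ)) (by push_cast; exact ⟨le_rfl, le_rfl⟩)).2
  push_cast at hSL hTL hSU hQU hTH hAlo hTop
  norm_num at hSL hTL hSU hQU hTH hAlo hTop
  obtain ⟨hΔl, hΔu⟩ := hΔ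
  obtain ⟨hal, hau⟩ := ha
  constructor
  · have hlow := fsRatio_fermiEnergyOf_trueCorner_lower (Δ₁ := ((397 : ℝ) / 100)) (a₁ := ((117 : ℝ) / 100)) (b₁ := ((14 : ℝ) / 25)) (b₂ := ((17 : ℝ) / 25)) (c₁ := ((121 : ℝ) / 1000)) (c₂ := ((123 : ℝ) / 1000))
      (ν := ((91 : ℝ) / 200)) (pL := ((5207 : ℝ) / 5000)) (qL := ((5359 : ℝ) / 5000)) (Mb := (0 : ℝ)) (Mc := ((11377 : ℝ) / 10000)) (by norm_num) hΔl (by norm_num) hal (by norm_num) hb (by norm_num) hc (by norm_num) (by norm_num) (by norm_num)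
      (by norm_num) hSL.1 hAlo.2 (by norm_num) (by norm_num [fsD, fsN]) (by norm_num) (by norm_num) (by norm_num [fsD, fsN]) (by norm_num) (by norm_num [dopingDisc]) (by norm_num [fsD, fsN])
    refine le_trans ?_ hlow
    have hw := (fsRatio_mem_Icc_on_window_of_dopingDisc_nonneg (Δ := ((397 : ℝ) / 100)) (a := ((117 : ℝ) / 100)) (b := ((17 : ℝ) / 25)) (c := ((123 : ℝ) / 1000))
      (p := ((5303 : ℝ) / 5000)) (q := ((5353 : ℝ) / 5000)) (by norm_num) (by norm_num) (by norm_num) (by norm_num) (by norm_num) (by norm_num) (by norm_num) (by norm_num [dopingDisc]) hTL).1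
    refine le_trans ?_ hw
    norm_num [fsRatio, fsD, fsN]
  · have hup := fsRatio_fermiEnergyOf_trueCorner_upper (Δ₁ := ((397 : ℝ) / 100)) (Δ₂ := (5 : ℝ)) (a₁ := ((117 : ℝ) / 100)) (a₂ := ((137 : ℝ) / 100)) (b₁ := ((14 : ℝ) / 25)) (b₂ := ((17 : ℝ) / 25)) (c₁ := ((121 : ℝ) / 1000)) (c₂ := ((123 : ℝ) / 1000))
      (ν := ((91 : ℝ) / 200)) (pU := ((2317 : ℝ) / 2000)) (qU := ((5927 : ℝ) / 5000)) (qT := ((3447 : ℝ) / 2500)) (Mb := ((1339 : ℝ) / 5000)) (Mc := ((519 : ℝ) / 1000)) (by norm_num) ⟨hΔl, hΔu⟩ (by norm_num) ⟨hal, hau⟩ (by norm_num) hb (by norm_num) hc (by norm_num) (by norm_num) (by norm_num)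
      hTop.2 (by norm_num) (by norm_num) hSU.1 hQU.2 (by norm_num) (by norm_num [fsD, fsN]) (by norm_num) (by norm_num) (by norm_num [fsD, fsN]) (by norm_num) (by norm_num) (by norm_num [fsD, fsN])
    refine le_trans hup ?_
    have hw := (fsRatio_mem_Icc_on_window_of_dopingDisc_nonneg (Δ := (5 : ℝ)) (a := ((137 : ℝ) / 100)) (b := ((14 : ℝ) / 25)) (c := ((121 : ℝ) / 1000))
      (p := ((2319 : ℝ) / 2000)) (q := ((2339 : ℝ) / 2000)) (by norm_num) (by norm_num) (by norm_num) (by norm_num) (by norm_num) (by norm_num) (by norm_num) (by norm_num [dopingDisc]) hTH).2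
    refine le_trans hw ?_
    norm_num [fsRatio, fsD, fsN]

end Summit.Ventures.CertifiedManyBodySolver.Downfold.Emery
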